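import Summits.BirchSwinnertonDyer.BirchSwinnertonDyer.Theorems.ClassRecordThreeCornerAtThreeUpperShimuraAnchorTailEmpty
import Summits.BirchSwinnertonDyer.BirchSwinnertonDyer.Theorems.ClassRecordThreeCornerAtThreeShapeInertiaTorsion
import HarnessLib

/-!
# Crux `CornerAtThreeW` (item stmt-BirchSwinnertonDyer-21420; 19111 `CornerAtThree` aside), conjunct (U): THE TRICHOTOMY OF THE CORNER UNDER THE
# `3`-ANCHOR PREDICATES — every (T4″)₃ corner curve is admissible-anchor as it stands, OR admissible up to one exempted place, OR has `3` as its ONLY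
# multiplicative prime; so the residual binder of the line (`hres` of the one-call consumer, `residual3_of_stubs` of `Lines/inert.lean` r15) is consumed
# EXACTLY on the `Mult = {3}` corner curves, where `3` is split multiplicative
# (cell `bsd-stepL`, seat `bsd-stepL-corner3-p2` g13 = WIDTH-LEVER lane B; `--supports stmt-BirchSwinnertonDyer-21420 --as helper`)

WHAT. `…UpperShimuraAnchorTailEmpty` (this seat, p637138) emptied the MULTI-carrier part of the residual population
«`¬ Three.CornerInertAdmissibleAnchor W ∧ ¬ Three.CornerInertAdmissibleUpToOneAnchor W`». This file describes the whole residual population on the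
corner, class-wide, by the same finite-set bookkeeping as lane B g12's tail lemma (offenders `Off` = split multiplicative `ℓ ≠ 3` with `3 ∣ ord_ℓ Δ_min`;
`S = {3} ∪ Off` when `#Off` is odd, `S = {3, m} ∪ Off` with a spare multiplicative `m`, the up-to-one road exempting one offender when `#Off` is even
and non-empty; and when `Off = ∅` with no spare prime, EVERY multiplicative prime is `3`), the Tamagawa shape being automatic on the corner (lane B g4,
`Three.hasSplitMultiplicativeReductionAtPrime_of_three_dvd_of_not_surj`):
* `Three.cornerInertAdmissibleAnchor_or_upToOneAnchor_or_forall_mult_eq_three` — THE TRICHOTOMY;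
* `Three.forall_mult_eq_three_of_not_anchor_of_not_upToOneAnchor` — admissible-anchor neither way ⟹ `Mult = {3}`;
* `Three.hasSplitMultiplicativeReductionAtPrime_three_of_not_anchor_of_not_upToOneAnchor` — … and if moreover `3 ∣ ∏ c` then `3` is SPLIT multiplicative
  (the split prime supplied by `Three.three_dvd_tamagawaProduct_iff_exists_split_of_not_surj` is multiplicative, hence `= 3`);
* `Three.not_anchor_and_not_upToOneAnchor_of_forall_mult_eq_three` — the converse on the split-at-`3` corner: `Mult = {3}` ⟹ admissible-anchor neither way
  (`3` is a split offender — `3 ∣ ord₃ Δ_min` on the corner, `ClassX11b.dvd_and_not_ram_of_not_surj` — so every admissible `S` contains `3`, is even, and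
  consists of multiplicative primes: impossible inside `{3}`).
Hence the census row «mono ∕ TAIL 41 = `Mult = {3}`» (lane B g12, `corner3/g12/census`) is a THEOREM-LEVEL description of where the line's X₀(N) Jetchev MAX
walk (the mono branch, two image-free Gross facts) is the only road: no even non-empty set of multiplicative primes exists, so no Shimura frame `X_{N⁺,N⁻}` does.

HONEST FRAMING: THEOREMS ONLY (finite-set bookkeeping on two kernel theorems of this seat; no definition, no named fact, no `sorry`); nothing about any
L-value, Selmer group or Heegner point is proved here; nothing here is a BSD class theorem; no census label moves (T7); 21420 ∕ 19111 NOT closed; BSD is proved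
for no curve. Credit: lane B g12 (the bookkeeping of the tail lemma, adapted), lane B g4 (shape), x11b3 (carrier dictionary), idea-crit-14 ∕ bsd-idea-9 ∕ LEAD er5-p1
∕ w2 (the anchor). References (locators only): [cite: PastenShimura2024, Lemmas 6.15, 6.16 and 6.18 (arXiv v4 pp. 30–33)] [cite: Jetchev2008, Thm. 1.1, Cor. 1.5]
[cite: Serre1972, §2.4 Prop. 15] [cite: SilvermanATAEC1994, Cor. IV.9.2 (d) and Table 4.1] [cite: GrossLMS1991, §3 Prop. 3.7 (2), §6 (the X₀(N) road)].
-/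

set_option autoImplicit false
set_option linter.dupNamespace false -- `Summit.BirchSwinnertonDyer.BirchSwinnertonDyer` (summit = problem), tree-wide

noncomputable section

open scoped Classical NumberField

open WeierstrassCurve NumberField IsDedekindDomain CongruenceSubgroup Literature.NumberTheory.EllipticCurves
  Literature.NumberTheory.EllipticCurves.ModularForms Literature.NumberTheory.Automorphic
  Literature.NumberTheory.EllipticCurves.Rank1Residual Literature.NumberTheory.EllipticCurves.Rank1Residual.Typed
  Literature.NumberTheory.EllipticCurves.BarriosEtAl2025
  Summit.BirchSwinnertonDyer.Rank1Residual Summit.BirchSwinnertonDyer.Rank1Residual.X11b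

namespace Summit.BirchSwinnertonDyer.BirchSwinnertonDyer.Theorems

/-! ### §1. The trichotomy -/

/-- **THE TRICHOTOMY OF THE (T4″)₃ CORNER under the `3`-anchor predicates.** For `E = W/ℚ` globally minimal with `ClassX11b W 3` and `ρ̄_{E,3}` not onto:
`Three.CornerInertAdmissibleAnchor W`, or `Three.CornerInertAdmissibleUpToOneAnchor W`, or EVERY multiplicative prime of `E` is `3`. Bookkeeping on the
split offenders `Off` (`≠ 3`): `#Off` odd ⟹ `S = {3} ∪ Off`; `#Off` even with a spare multiplicative prime `m ∉ Off ∪ {3}` ⟹ `S = {3, m} ∪ Off`; `#Off` even,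
non-empty, no spare ⟹ exempt one offender; `Off = ∅`, no spare ⟹ `Mult = {3}`. The Tamagawa shape is lane B g4's theorem on the corner.
-- adapted from Summits/BirchSwinnertonDyer/BirchSwinnertonDyer/Theorems/ClassRecordThreeCornerAtThreeUpperShimuraAnchorTail.lean
[cite: PastenShimura2024, Lemmas 6.15, 6.16 and 6.18] [cite: Jetchev2008, Cor. 1.5] [cite: Serre1972, §2.4 Prop. 15] -/
theorem Three.cornerInertAdmissibleAnchor_or_upToOneAnchor_or_forall_mult_eq_three
    (W : WeierstrassCurve ℚ) [W.IsElliptic] [W.IsGloballyMinimal] (hX : ClassX11b W 3) (hns : ¬ Surj W 3) :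
    Three.CornerInertAdmissibleAnchor W ∨ Three.CornerInertAdmissibleUpToOneAnchor W ∨
      ∀ (m : ℕ) [Fact m.Prime], Mult W m → m = 3 := by
  haveI : Fact (Nat.Prime 3) := ⟨Nat.prime_three⟩
  have hshape : ∀ (q : ℕ) [Fact q.Prime], 3 ∣ (W.baseChange ℚ_[q]).localTamagawaNumber ℤ_[q] →
      W.HasSplitMultiplicativeReductionAtPrime q :=
    fun q _ h3 ↦ Three.hasSplitMultiplicativeReductionAtPrime_of_three_dvd_of_not_surj W hX hns q h3
  have hmult : Mult W 3 := hX.2.2.1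
  have hN0 : W.conductorNorm ℤ ≠ 0 := Nat.pos_iff_ne_zero.mp (WeierstrassCurve.conductorNorm_pos_holds (W := W))
  have h3good : ¬ 3 ∣ 3 - 1 := by decide
  -- the offenders `≠ 3`
  set POff : ℕ → Prop := fun q ↦ ∃ _ : Fact q.Prime, q ≠ 3 ∧ W.HasSplitMultiplicativeReductionAtPrime q ∧
    3 ∣ padicValInt q W.minimalDiscriminantInt with hPOff
  set Off : Finset ℕ := (W.conductorNorm ℤ).primeFactors.filter POff with hOffdef
  have memOff : ∀ q : ℕ, q ∈ Off ↔ POff q := by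
    intro q
    simp only [hOffdef, Finset.mem_filter, Nat.mem_primeFactors]
    refine ⟨fun h ↦ h.2, fun h ↦ ⟨?_, h⟩⟩
    obtain ⟨hF, -, hs, -⟩ := h
    exact ⟨hF.out, dvd_conductorNorm_of_mult hs.hasMultiplicativeReductionAtPrime, hN0⟩
  have h3Off : 3 ∉ Off := fun h ↦ ((memOff 3).mp h).2.1 rfl
  -- bookkeeping for `insert 3 X`, `X ⊆ Off`
  have multOf : ∀ X : Finset ℕ, X ⊆ Off → ∀ q ∈ insert 3 X, ∃ _ : Fact q.Prime, Mult W q := by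
    intro X hX' q hq
    rcases Finset.mem_insert.mp hq with rfl | hq
    · exact ⟨inferInstance, hmult⟩
    · obtain ⟨hF, -, hs, -⟩ := (memOff q).mp (hX' hq)
      exact ⟨hF, hs.hasMultiplicativeReductionAtPrime⟩
  have fcOf : ∀ (q : ℕ) [Fact q.Prime], q ∉ insert 3 Off → W.HasSplitMultiplicativeReductionAtPrime q →
      ¬ 3 ∣ padicValInt q W.minimalDiscriminantInt := by
    intro q _ hq hs hd
    rcases eq_or_ne q 3 with rfl | hq3
    · exact hq (Finset.mem_insert_self _ _)
    · exact hq (Finset.mem_insert_of_mem ((memOff q).mpr ⟨inferInstance, hq3, hs, hd⟩))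
  rcases Nat.even_or_odd Off.card with hev | hodd
  · by_cases hspare : ∃ (m : ℕ) (_ : Fact m.Prime), Mult W m ∧ m ≠ 3 ∧ m ∉ Off
    · -- a spare multiplicative prime fixes the parity: `S = {3, m} ∪ Off`
      obtain ⟨m, hmF, hmm, hm3, hmOff⟩ := hspare
      have h3m : (3 : ℕ) ∉ insert m Off := by
        rw [Finset.mem_insert]
        rintro (h | h)
        · exact hm3 h.symm
        · exact h3Off h
      refine Or.inl ⟨hshape, insert 3 (insert m Off), ?_, ?_, ?_,
        Or.inr ⟨3, Finset.mem_insert_self _ _, Or.inr (Or.inl h3good)⟩⟩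
      · intro q hq
        rcases Finset.mem_insert.mp hq with rfl | hq
        · exact ⟨inferInstance, hmult⟩
        rcases Finset.mem_insert.mp hq with rfl | hq
        · exact ⟨hmF, hmm⟩
        · exact multOf Off le_rfl q (Finset.mem_insert_of_mem hq)
      · rw [Finset.card_insert_of_notMem h3m, Finset.card_insert_of_notMem hmOff]
        obtain ⟨n, hn⟩ := hev
        exact ⟨n + 1, by omega⟩
      · intro q _ hq hs
        refine fcOf q (fun h ↦ hq ?_) hs
        rcases Finset.mem_insert.mp h with rfl | h
        · exact Finset.mem_insert_self _ _
        · exact Finset.mem_insert_of_mem (Finset.mem_insert_of_mem h)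
    · rcases Finset.eq_empty_or_nonempty Off with hOff0 | ⟨ℓ, hℓOff⟩
      · -- no offender `≠ 3` and no spare multiplicative prime: EVERY multiplicative prime is `3`
        refine Or.inr (Or.inr fun m _ hmm ↦ ?_)
        by_contra hm3
        exact hspare ⟨m, inferInstance, hmm, hm3, by rw [hOff0]; exact Finset.notMem_empty m⟩
      · -- no spare prime, an offender `ℓ`: exempt it (the up-to-one road)
        obtain ⟨hℓF, hℓ3, hℓs, -⟩ := (memOff ℓ).mp hℓOff
        have h3E : (3 : ℕ) ∉ Off.erase ℓ := fun h ↦ h3Off (Finset.mem_of_mem_erase h)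
        refine Or.inr (Or.inl ⟨ℓ, hℓF, ?_, fun q _ _ hq ↦ hshape q hq, insert 3 (Off.erase ℓ), ?_, ?_,
          Finset.mem_insert_self _ _, ?_, ?_⟩)
        · exact WeierstrassCurve.HasMultiplicativeReduction.not_hasGoodReduction (R := ℤ_[ℓ])
            hℓs.hasMultiplicativeReductionAtPrime
        · exact multOf (Off.erase ℓ) (Finset.erase_subset _ _)
        · rw [Finset.card_insert_of_notMem h3E, Finset.card_erase_of_mem hℓOff]
          obtain ⟨n, hn⟩ := hev
          have : 0 < Off.card := Finset.card_pos.mpr ⟨ℓ, hℓOff⟩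
          exact ⟨n, by omega⟩
        · rw [Finset.mem_insert, Finset.mem_erase, not_or, not_and]
          exact ⟨hℓ3, fun h _ ↦ h rfl⟩
        · intro q _ hq hqℓ hs hd
          rcases eq_or_ne q 3 with rfl | hq3
          · exact hq (Finset.mem_insert_self _ _)
          · exact hq (Finset.mem_insert_of_mem (Finset.mem_erase.mpr
              ⟨hqℓ, (memOff q).mpr ⟨inferInstance, hq3, hs, hd⟩⟩))
  · -- `#Off` odd: `S = {3} ∪ Off`
    refine Or.inl ⟨hshape, insert 3 Off, multOf Off le_rfl, ?_, fcOf,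
      Or.inr ⟨3, Finset.mem_insert_self _ _, Or.inr (Or.inl h3good)⟩⟩
    rw [Finset.card_insert_of_notMem h3Off]
    obtain ⟨n, hn⟩ := hodd
    exact ⟨n + 1, by omega⟩

/-! ### §2. The residual population of the line: `Mult = {3}`, `3` split -/

/-- **Admissible-anchor NEITHER as it stands NOR up to one exempted place ⟹ `3` is the ONLY multiplicative prime** (class-wide on the corner). This is
where the residual binder `hres` of `cornerAtThreeUpperConsumed_of_primitivesDivAtThreeInertD_of_displays_of_residualAnchor_of_twinLower` (`…UpperShimuraAnchorGlue`)
and `residual3_of_stubs` of `Lines/inert.lean` (r14∕r15) are consumed — the X₀(N) Jetchev MAX walk of the mono branch; census: 41 pairs below `5·10⁵`.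
[cite: Jetchev2008, Thm. 1.1, Cor. 1.5 (shape)] [cite: GrossLMS1991, §6 (the X₀(N) road)] -/
theorem Three.forall_mult_eq_three_of_not_anchor_of_not_upToOneAnchor (W : WeierstrassCurve ℚ) [W.IsElliptic] [W.IsGloballyMinimal]
    (hX : ClassX11b W 3) (hns : ¬ Surj W 3) (hnadm : ¬ Three.CornerInertAdmissibleAnchor W)
    (hnadm1 : ¬ Three.CornerInertAdmissibleUpToOneAnchor W) : ∀ (m : ℕ) [Fact m.Prime], Mult W m → m = 3 := by
  rcases Three.cornerInertAdmissibleAnchor_or_upToOneAnchor_or_forall_mult_eq_three W hX hns with h | h | h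
  · exact absurd h hnadm
  · exact absurd h hnadm1
  · exact h

/-- **… and if `3 ∣ ∏_ℓ c_ℓ(E)` then `3` is SPLIT multiplicative**: the split multiplicative prime supplied on the corner by
`Three.three_dvd_tamagawaProduct_iff_exists_split_of_not_surj` (`…CornerAtThreeShapeInertiaTorsion`, lane B g4) is multiplicative, hence `= 3`. So the residual
binder of the line is consumed exactly on the corner curves with `Mult = {3}`, `3` split, `3 ∣ ord₃ Δ_min` (census label «mono ∕ split3 ∕ TAIL», 41 pairs).
[cite: SilvermanATAEC1994, Cor. IV.9.2 (d) and Table 4.1] [cite: Serre1972, §2.4 Prop. 15] -/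
theorem Three.hasSplitMultiplicativeReductionAtPrime_three_of_not_anchor_of_not_upToOneAnchor (W : WeierstrassCurve ℚ) [W.IsElliptic]
    [W.IsGloballyMinimal] [Fact (Nat.Prime 3)] (hX : ClassX11b W 3) (hns : ¬ Surj W 3) (ht : 3 ∣ W.tamagawaProduct)
    (hnadm : ¬ Three.CornerInertAdmissibleAnchor W) (hnadm1 : ¬ Three.CornerInertAdmissibleUpToOneAnchor W) :
    W.HasSplitMultiplicativeReductionAtPrime 3 := by
  obtain ⟨ℓ, hℓF, hℓs⟩ := (Three.three_dvd_tamagawaProduct_iff_exists_split_of_not_surj W hX hns).mp ht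
  have hℓ3 : ℓ = 3 :=
    Three.forall_mult_eq_three_of_not_anchor_of_not_upToOneAnchor W hX hns hnadm hnadm1 ℓ hℓs.hasMultiplicativeReductionAtPrime
  subst hℓ3
  exact hℓs

/-- **The converse on the split-at-`3` corner: `Mult = {3}` ⟹ admissible-anchor NEITHER way.** On the corner `3 ∣ ord₃ Δ_min`
(`ClassX11b.dvd_and_not_ram_of_not_surj`), so when `3` is split multiplicative it is a split offender and every admissible `S` must contain `3`, be even and
consist of multiplicative primes — impossible inside `Mult = {3}`; the up-to-one predicate needs `3 ∈ S`, `S` even, too. With §2's first two theorems this makes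
the residual population of the line EXACTLY «`Mult = {3}`, `3` split» among the corner curves with `3 ∣ ∏ c`. [cite: PastenShimura2024, Lemma 6.18 (shape)]
[cite: Serre1972, §2.4 Prop. 15] -/
theorem Three.not_anchor_and_not_upToOneAnchor_of_forall_mult_eq_three (W : WeierstrassCurve ℚ) [W.IsElliptic] [W.IsGloballyMinimal]
    [Fact (Nat.Prime 3)] (hX : ClassX11b W 3) (hns : ¬ Surj W 3) (hs3 : W.HasSplitMultiplicativeReductionAtPrime 3)
    (honly : ∀ (m : ℕ) [Fact m.Prime], Mult W m → m = 3) :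
    ¬ Three.CornerInertAdmissibleAnchor W ∧ ¬ Three.CornerInertAdmissibleUpToOneAnchor W := by
  have hd3 : 3 ∣ padicValInt 3 W.minimalDiscriminantInt := (ClassX11b.dvd_and_not_ram_of_not_surj W 3 hX hns).1
  -- every admissible `S` lies inside `{3}`
  have hsub : ∀ S : Finset ℕ, (∀ ℓ ∈ S, ∃ _ : Fact ℓ.Prime, Mult W ℓ) → S ⊆ {3} := by
    intro S hS ℓ hℓ
    obtain ⟨hF, hm⟩ := hS ℓ hℓ
    exact Finset.mem_singleton.mpr (honly ℓ hm)
  have hcard : ∀ S : Finset ℕ, (∀ ℓ ∈ S, ∃ _ : Fact ℓ.Prime, Mult W ℓ) → 3 ∈ S → S.card = 1 := by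
    intro S hS h3
    rw [Finset.eq_singleton_iff_unique_mem.mpr ⟨h3, fun ℓ hℓ ↦ Finset.mem_singleton.mp (hsub S hS hℓ)⟩, Finset.card_singleton]
  refine ⟨?_, ?_⟩
  · rintro ⟨-, S, hSmult, hSeven, hFC, -⟩
    by_cases h3S : 3 ∈ S
    · rw [hcard S hSmult h3S] at hSeven
      exact Nat.not_even_one hSeven
    · exact hFC 3 h3S hs3 hd3
  · rintro ⟨q₁, hq₁F, -, -, S, hSmult, hSeven, h3S, -, -⟩
    rw [hcard S hSmult h3S] at hSeven
    exact Nat.not_even_one hSeven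

end Summit.BirchSwinnertonDyer.BirchSwinnertonDyer.Theorems

end
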